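import Summits.ResolutionOfSingularities.ResolutionOfSingularities.Theorems.PurelyInseparableDim4ResConeLightTripleStep
import Summits.ResolutionOfSingularities.ResolutionOfSingularities.Theorems.PurelyInseparableDim4FreeTailLemma
import HarnessLib
import HarnessLib.Audit.Tags

/-!
# Purely inseparable four-folds — the LIGHT TRIPLE TAIL, part 3 (K25c): NO INFINITE TRIPLE-MERGED LIGHT TAIL
# (K2(p) lane, slice B, the A∞ assembly; cell `res-dim4-pi`)

[OURS · counted 0 · cell `res-dim4-pi` · K2(p) lane holder res-dim4-p-12 g3's brick (K25) «A∞(T) ASSEMBLY =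
light triple tail» by signature (bus 2026-08-29 00:46Z; assembly logic idea-4 g3 00:32Z / holder 00:46Z),
seat res-dim4-p-2 g4 (lineage res-dim4-p-2).]  Nothing here proves K2(p)/K2(5) (the light regime stays OPEN:
this closes its A∞ = triple-merged part from the ENTRY state on; the entry (K26) and the two-slot class C∞ (K24)
are separate), `NoIsolatedTrap p p` or resolution of singularities in dimension ≥ 4 / characteristic `p`.  AI
kernel work, weaker than expert review.

THE CLAIM (`no_light_triple_tail`).  On an isolated above-floor `Step0 p` chain with witnesses `(j, b)`,
`x^{r₀} ∣ F₀`, constant shade `d = 3 < p` and frame data from `k₀` on (`ResCone.chain_powerCone_package`), light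
(`p ≤ r_X + r_Y + 3` for any two boundary letters of positive weight, from `k₁` on), fix two letters `B ≠ C`.  If at
some `k₁ ≥ k₀` the state carries a TRIPLE-MERGED LEDGER `u·G = S·(x_N x_B x_C) + T·h^d` (`u(0) ≠ 0`, `h ∈ 𝔪₀`,
`lin h = κ·L_{k₁}`) on three boundary letters `N, B, C` of positive weight, the fourth letter free and carrying
`L_{k₁}`, and step `k₁` KEEPS `B` and `C`, then `False`.
Route (`lightTriple_step`, by `Nat.le_induction`): the invariant «triple ledger on `{N_k, B, C}`, `B, C` kept at
step `k`» propagates with `N_{k+1} = j_k` — part 2's `triple_step` transports it and yields the exact contact form,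
legality and the minors `m_B, m_C ≠ 0`; part 1's `r_eq_of_triple_ledger` + the floor make «chart in `{j_k, B, C}`
keeping the other two, or free chart translating exactly one» the complete move list at `k + 1`
(`kept_of_count`); a move re-creating or translating `B` (resp. `C`) is LEGAL only with `σ′(w′) = 0`
(`triple_step` once more, on the permuted triple) which together with `ℓ′(w′) = 0` says `m_B = 0` (resp.
`m_C = 0`) — excluded (`triple_no_drop`); so step `k + 1` keeps `B, C` and is FREE w.r.t. `x_{j_k}`
(`¬ FreeTail.IsSatellite j b k`).  An all-free isolated tail contradicts the tree's free-tail theorem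
`FreeTailProof.noIsolatedFreeTailAt_self`.  `no_light_triple_tail_five`: at `p = 5` the light bound is automatic.
bears_on: LADDER-RESOLUTION:D157-DOOR2 (res-dim4-pi · K2(p) · slice B · K25c).  Supports
stmt-ResolutionOfSingularities-16155 (helper).
-/

set_option linter.dupNamespace false -- mandated namespace of this single-conjunct summit

noncomputable section

namespace Summit.ResolutionOfSingularities.ResolutionOfSingularities.Theorems.PIDim4

namespace ResCone

open MvPolynomial Finset
open Literature.AlgebraicGeometry.Resolution
open Literature.AlgebraicGeometry.Resolution.CentreBlowup
open Literature.AlgebraicGeometry.Resolution.Hauser2010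
open Literature.AlgebraicGeometry.Resolution.HauserPerlega2019
open PointBlowup (polarMap additiveSubspace direction)

variable {K : Type} [Field K]

section Chain

variable (p : ℕ) [hp : Fact p.Prime] [CharP K p] [DecidableEq K]

/-- **NO MOVE DROPS A MINOR LETTER** (K25c; idea-4: «after a λ-step a μ-step is ILLEGAL»): at a stage `m` carrying a
triple ledger on `{χ, θ, ν}` whose cofactor's linear coefficients off `θ` are `U₀·σ` and whose vertex form off `θ`
is `λ₀·ℓ` with the minor `σ_χ ℓ_e − σ_e ℓ_χ ≠ 0` (`e` the free letter), a step re-creating `χ` (chart `χ`) or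
translating `χ` from the free chart (chart `e`), keeping `θ, ν`, is impossible: its legality `σ′(w′) = 0`
(part 2's `triple_step` on the triple `(χ, θ, ν)`) and `ℓ′(w′) = 0` force the minor to vanish. [OURS]
[cite: CossartJannsenSaito2020, Thm. 3.10(4), Thm. 3.14, Thm. 9.3] -/
theorem triple_no_drop {c : ℕ → State K} {j : ℕ → Fin 4} {b : ℕ → Fin 4 → K}
    (hc : ∀ k, IsIsolated p (c k).F ∧ Step0 p (c k) (c (k + 1))) (hw : FreeTail.IsWitnessedChain p c j b)
    (hr0 : ∀ e ∈ (c 0).F.support, (c 0).r ≤ e) (hfloor : ∀ k, ordZero (c k).F ≠ p) {k₀ d : ℕ} (hd3 : d = 3)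
    (hdp : d < p) (hshade : ∀ k, k₀ ≤ k → (c k).shade = (d : ℕ∞)) {m : ℕ} (hm : k₀ ≤ m)
    {ℓm ℓm' : Fin 4 → K} {a₀ a₀' lam : K}
    (hform : resForm (c m) = C a₀ * (∑ i, C (ℓm i) * X i) ^ d) (hdir : ℓm (j m) + dotProduct ℓm (b m) = 0)
    (hform' : resForm (c (m + 1)) = C a₀' * (∑ i, C (ℓm' i) * X i) ^ d) (hlam : lam ≠ 0)
    (hprop : ∀ i, i ≠ j m → ℓm' i = lam * ℓm i)
    (hw3' : ∀ i₁ i₂ : Fin 4, i₁ ≠ i₂ → 1 ≤ (c (m + 1)).r i₁ → 1 ≤ (c (m + 1)).r i₂ →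
      p ≤ (c (m + 1)).r i₁ + (c (m + 1)).r i₂ + 3)
    {χ θ ν e : Fin 4} (hχθ : χ ≠ θ) (hχν : χ ≠ ν) (hθν : θ ≠ ν) (heχ : e ≠ χ) (heθ : e ≠ θ)
    (heν : e ≠ ν) (hrθ : 1 ≤ (c m).r θ) (hrν : 1 ≤ (c m).r ν) (hre : (c m).r e = 0)
    {u S T h : MvPolynomial (Fin 4) K} {κ : K} (hu : MvPolynomial.eval (0 : Fin 4 → K) u ≠ 0)
    (hh : h ∈ originIdeal K) (hlin : homogeneousComponent 1 h = C κ * (∑ i, C (ℓm i) * X i))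
    (hG : u * ((c m).F.divMonomial (c m).r) = S * (X χ * X θ * X ν) +
      T * h ^ d)
    {σ ℓ : Fin 4 → K} {U₀ lam₀ : K} (hU₀ : U₀ ≠ 0) (hlam₀ : lam₀ ≠ 0)
    (hcoef : ∀ i, i ≠ θ → coeff (Finsupp.single i 1) S = U₀ * σ i) (hℓ : ∀ i, i ≠ θ → ℓm i = lam₀ * ℓ i)
    (hℓe : ℓ e ≠ 0) (hminor : σ χ * ℓ e - σ e * ℓ χ ≠ 0)
    (hbθ : b m θ = 0) (hbν : b m ν = 0) (hjm : j m = χ ∨ j m = e) : False := by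
  classical
  have hℓme : ℓm e ≠ 0 := by rw [hℓ e heθ]; exact mul_ne_zero hlam₀ hℓe
  have hjl : j m ≠ θ := by rcases hjm with h1 | h1 <;> rw [h1]; exacts [hχθ, heθ]
  have hjY : j m ≠ ν := by rcases hjm with h1 | h1 <;> rw [h1]; exacts [hχν, heν]
  obtain ⟨-, -, -, -, -, -, -, -, -, -, -, -, -, -, -, -, hleg, -⟩ :=
    triple_step p hc hw hr0 hfloor hd3 hdp hshade hm hform hdir hform' hlam hprop hw3' hχθ hχν hθν heχ heθ heν hrθ
      hrν hre hℓme hbθ hbν hjl hjY hu hh hlin hG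
  have hbj := (hw m).2.1
  -- the two linear equations on `{X, e}`: legality `σ′(w′) = 0` and the direction `ℓ′(w′) = 0`
  have hsum1 : (∑ i, coeff (Finsupp.single i 1) S * b m i * (if i = j m then (0 : K) else 1)) =
      coeff (Finsupp.single χ 1) S * b m χ + coeff (Finsupp.single e 1) S * b m e := by
    have h1 : ∀ i, coeff (Finsupp.single i 1) S * b m i * (if i = j m then (0 : K) else 1) =
        coeff (Finsupp.single i 1) S * b m i := fun i => by
      split_ifs with hi
      · rw [hi, hbj]; ring
      · rw [mul_one]
    simp_rw [h1]
    rw [sum_univ_of_four hχθ hχν heχ.symm hθν heθ.symm heν.symm, hbθ, hbν]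
    ring
  have hsum2 : dotProduct ℓm (b m) = ℓm χ * b m χ + ℓm e * b m e := by
    unfold dotProduct
    rw [sum_univ_of_four hχθ hχν heχ.symm hθν heθ.symm heν.symm, hbθ, hbν]
    ring
  rw [hsum1, hcoef χ hχθ, hcoef e heθ] at hleg
  rw [hsum2, hℓ χ hχθ, hℓ e heθ] at hdir
  apply hminor
  rcases hjm with h1 | h1
  · rw [h1] at hbj hleg hdir
    rw [hcoef χ hχθ, hbj] at hleg
    rw [hℓ χ hχθ, hbj] at hdir
    have e1 : σ χ + σ e * b m e = 0 := by
      have h2 : U₀ * (σ χ + σ e * b m e) = 0 := by linear_combination hleg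
      exact (mul_eq_zero.mp h2).resolve_left hU₀
    have e2 : ℓ χ + ℓ e * b m e = 0 := by
      have h2 : lam₀ * (ℓ χ + ℓ e * b m e) = 0 := by linear_combination hdir
      exact (mul_eq_zero.mp h2).resolve_left hlam₀
    linear_combination ℓ e * e1 - σ e * e2
  · rw [h1] at hbj hleg hdir
    rw [hcoef e heθ, hbj] at hleg
    rw [hℓ e heθ, hbj] at hdir
    have e1 : σ e + σ χ * b m χ = 0 := by
      have h2 : U₀ * (σ e + σ χ * b m χ) = 0 := by linear_combination hleg
      exact (mul_eq_zero.mp h2).resolve_left hU₀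
    have e2 : ℓ e + ℓ χ * b m χ = 0 := by
      have h2 : lam₀ * (ℓ e + ℓ χ * b m χ) = 0 := by linear_combination hdir
      exact (mul_eq_zero.mp h2).resolve_left hlam₀
    linear_combination σ χ * e2 - ℓ χ * e1

/-- **THE LIGHT TRIPLE STEP** (K25c): the invariant «triple-merged ledger on `{N, B, C}` with exact contact form,
`N, B, C` of positive weight, the fourth letter free and carrying the vertex form, `B, C` kept by step `k`»
propagates from `k` to `k + 1` with `N ↦ j_k`, and step `k + 1` is FREE with respect to `x_{j_k}`. [OURS]
[cite: CossartJannsenSaito2020, Thm. 3.10(4), Thm. 3.14, Thm. 9.3] -/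
theorem lightTriple_step {c : ℕ → State K} {j : ℕ → Fin 4} {b : ℕ → Fin 4 → K}
    (hc : ∀ k, IsIsolated p (c k).F ∧ Step0 p (c k) (c (k + 1))) (hw : FreeTail.IsWitnessedChain p c j b)
    (hr0 : ∀ e ∈ (c 0).F.support, (c 0).r ≤ e) (hfloor : ∀ k, ordZero (c k).F ≠ p) {k₀ d : ℕ} (hd3 : d = 3)
    (hdp : d < p) (hshade : ∀ k, k₀ ≤ k → (c k).shade = (d : ℕ∞)) {ℓ : ℕ → Fin 4 → K} {a0 lam : ℕ → K}
    (hform : ∀ k, k₀ ≤ k → resForm (c k) = C (a0 k) * (∑ i, C (ℓ k i) * X i) ^ d)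
    (hdir : ∀ k, k₀ ≤ k → ℓ k (j k) + dotProduct (ℓ k) (b k) = 0) (hlam : ∀ k, k₀ ≤ k → lam k ≠ 0)
    (hprop : ∀ k, k₀ ≤ k → ∀ i, i ≠ j k → ℓ (k + 1) i = lam k * ℓ k i)
    {μ ν : Fin 4} (hμν : μ ≠ ν) {k₁ : ℕ} (hk₁ : k₀ ≤ k₁)
    (hw3 : ∀ k, k₁ ≤ k → ∀ i₁ i₂ : Fin 4, i₁ ≠ i₂ → 1 ≤ (c k).r i₁ → 1 ≤ (c k).r i₂ →
      p ≤ (c k).r i₁ + (c k).r i₂ + 3)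
    {k : ℕ} (hk : k₁ ≤ k) {N e : Fin 4} {u S T h : MvPolynomial (Fin 4) K} {κ : K}
    (hNB : N ≠ μ) (hNC : N ≠ ν) (heN : e ≠ N) (heB : e ≠ μ) (heC : e ≠ ν)
    (hu : MvPolynomial.eval (0 : Fin 4 → K) u ≠ 0) (hh : h ∈ originIdeal K)
    (hlin : homogeneousComponent 1 h = C κ * (∑ i, C (ℓ k i) * X i))
    (hG : u * ((c k).F.divMonomial (c k).r) = S * (X N * X μ * X ν) + T * h ^ d)
    (hrB : 1 ≤ (c k).r μ) (hrC : 1 ≤ (c k).r ν) (hre : (c k).r e = 0)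
    (hℓe : ℓ k e ≠ 0) (hbB : b k μ = 0) (hbC : b k ν = 0) (hjB : j k ≠ μ) (hjC : j k ≠ ν) :
    ¬ FreeTail.IsSatellite j b k ∧
      ∃ (N' e' : Fin 4) (u' S' T' h' : MvPolynomial (Fin 4) K) (κ' : K),
        N' ≠ μ ∧ N' ≠ ν ∧ e' ≠ N' ∧ e' ≠ μ ∧ e' ≠ ν ∧
        MvPolynomial.eval (0 : Fin 4 → K) u' ≠ 0 ∧ h' ∈ originIdeal K ∧
        homogeneousComponent 1 h' = C κ' * (∑ i, C (ℓ (k + 1) i) * X i) ∧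
        u' * ((c (k + 1)).F.divMonomial (c (k + 1)).r) = S' * (X N' * X μ * X ν) + T' * h' ^ d ∧
        1 ≤ (c (k + 1)).r μ ∧ 1 ≤ (c (k + 1)).r ν ∧ (c (k + 1)).r e' = 0 ∧
        ℓ (k + 1) e' ≠ 0 ∧ b (k + 1) μ = 0 ∧ b (k + 1) ν = 0 ∧ j (k + 1) ≠ μ ∧ j (k + 1) ≠ ν := by
  classical
  have hk0 : k₀ ≤ k := hk₁.trans hk
  have hd2 : 2 ≤ d := by omega
  -- part 2's step at `k` on the triple `(N, B, C)`
  obtain ⟨e', S', U, κ', he'j, he'B, he'C, hre', hℓe', hr'j1, hr'B, hr'C, hu', hh'm, hlin', hpres, -, hmB, hmC, hU,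
      hcoefS'⟩ :=
    triple_step p hc hw hr0 hfloor hd3 hdp hshade hk0 (hform k hk0) (hdir k hk0) (hform (k + 1) (by omega))
      (hlam k hk0) (hprop k hk0) (hw3 (k + 1) (by omega)) hNB hNC hμν heN heB heC hrB hrC hre hℓe hbB hbC hjB hjC
      hu hh hlin hG
  have hℓ'e' : ℓ (k + 1) e' ≠ 0 := by rw [hprop k hk0 e' he'j]; exact mul_ne_zero (hlam k hk0) hℓe'
  have hr'B1 : 1 ≤ (c (k + 1)).r μ := by rw [hr'B]; exact hrB
  have hr'C1 : 1 ≤ (c (k + 1)).r ν := by rw [hr'C]; exact hrC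
  -- data at `k + 1` and `k + 2`
  obtain ⟨o', ho', -, -, hod'⟩ := chain_shade_nat p hc hfloor hshade (show k₀ ≤ k + 1 by omega)
  obtain ⟨o'', ho'', hpo'', -, hod''⟩ := chain_shade_nat p hc hfloor hshade (show k₀ ≤ k + 2 by omega)
  have hr' := IsolatedBand.isolated_chain_forall_le hc hr0 (k + 1)
  have hck' := (hw (k + 1)).2.2.2.2
  have hbj' := (hw (k + 1)).2.1
  have hisoG' : IsIsolated p (monomial (c (k + 1)).r (1 : K) * ((c (k + 1)).F.divMonomial (c (k + 1)).r)) := by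
    rw [monomial_mul_divMonomial hr']; exact (hc (k + 1)).1
  -- the three weights at `k + 1` are equal: `(w, w, w, 0)`, `p = 2w + 3`
  obtain ⟨hwB, hwC, hpw⟩ := r_eq_of_triple_ledger hjB hjC hμν hh'm hu' hpres hd2 _ hisoG'
    (hw3 (k + 1) (by omega) _ _ hjB hr'j1 hr'B1) (hw3 (k + 1) (by omega) _ _ hjC hr'j1 hr'C1)
    (hw3 (k + 1) (by omega) _ _ hμν hr'B1 hr'C1)
  set w := (c (k + 1)).r (j k) with hwdef
  -- the count: `|r″| ≥ 2w + 1` because `c (k+2)` is above the floor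
  have hrstep := step_r_univ p (j (k + 1)) hbj' (c (k + 1)) ho' hr'
  rw [← hck'] at hrstep
  have hdeg' : (c (k + 1)).r.degree = 3 * w := by
    rw [Finsupp.degree_eq_sum, sum_univ_of_four hjB hjC (Ne.symm he'j) hμν (Ne.symm he'B) (Ne.symm he'C),
      hwB, hwC, hre']
    ring
  have hdeg'' : (c (k + 2)).r.degree =
      (o' - p) + ∑ i ∈ Finset.univ.erase (j (k + 1)), (if b (k + 1) i = 0 then (c (k + 1)).r i else 0) := by
    rw [hrstep, Finsupp.degree_eq_sum, ← Finset.add_sum_erase _ _ (Finset.mem_univ (j (k + 1)))]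
    congr 1
    · rw [Finsupp.update_apply, if_pos rfl]
    · refine Finset.sum_congr rfl fun i hi => ?_
      rw [Finsupp.update_apply, if_neg (Finset.ne_of_mem_erase hi), Finsupp.filter_apply]
  have hcount : 2 * w + 1 ≤ w + ∑ i ∈ Finset.univ.erase (j (k + 1)),
      (if b (k + 1) i = 0 then (c (k + 1)).r i else 0) := by
    have h1 : o' - p = w := by omega
    rw [← h1, ← hdeg'']
    omega
  obtain ⟨hkeep, hfree⟩ := kept_of_count hjB hjC (Ne.symm he'j) hμν (Ne.symm he'B) (Ne.symm he'C) hr'j1 rfl hwB hwC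
    hre' hbj' hcount
  -- the four letters at `k + 1`
  have hcov : ∀ i : Fin 4, i = j k ∨ i = μ ∨ i = ν ∨ i = e' := fun i => by
    have h1 := Finset.mem_univ i
    rw [univ_eq_of_four hjB hjC (Ne.symm he'j) hμν (Ne.symm he'B) (Ne.symm he'C)] at h1
    simpa [Finset.mem_insert, Finset.mem_singleton] using h1
  -- the presentation at `k + 1` on the permuted triples `(B, j k, C)` and `(C, j k, B)`
  have hpresB : chartTransform 0 Finset.univ (j k) (shear (j k) (b k) u) * ((c (k + 1)).F.divMonomial (c (k + 1)).r) =
      S' * (X μ * X (j k) * X ν) +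
        ((∏ i ∈ Finset.univ.filter (fun i => b k i ≠ 0), (X i + C (b k i)) ^ ((c k).r i)) *
          chartTransform 0 Finset.univ (j k) (shear (j k) (b k) T)) *
          chartTransform 1 Finset.univ (j k) (shear (j k) (b k) h) ^ d := by
    rw [hpres]; ring
  have hpresC : chartTransform 0 Finset.univ (j k) (shear (j k) (b k) u) * ((c (k + 1)).F.divMonomial (c (k + 1)).r) =
      S' * (X ν * X (j k) * X μ) +
        ((∏ i ∈ Finset.univ.filter (fun i => b k i ≠ 0), (X i + C (b k i)) ^ ((c k).r i)) *
          chartTransform 0 Finset.univ (j k) (shear (j k) (b k) T)) *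
          chartTransform 1 Finset.univ (j k) (shear (j k) (b k) h) ^ d := by
    rw [hpres]; ring
  have hnodrop : ∀ {χ ψ : Fin 4}, χ ≠ j k → χ ≠ ψ → j k ≠ ψ → e' ≠ χ → e' ≠ ψ → 1 ≤ (c (k + 1)).r ψ →
      chartTransform 0 Finset.univ (j k) (shear (j k) (b k) u) * ((c (k + 1)).F.divMonomial (c (k + 1)).r) =
        S' * (X χ * X (j k) * X ψ) +
          ((∏ i ∈ Finset.univ.filter (fun i => b k i ≠ 0), (X i + C (b k i)) ^ ((c k).r i)) *
            chartTransform 0 Finset.univ (j k) (shear (j k) (b k) T)) *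
            chartTransform 1 Finset.univ (j k) (shear (j k) (b k) h) ^ d →
      coeff (Finsupp.single χ 1) S * ℓ k e' - coeff (Finsupp.single e' 1) S * ℓ k χ ≠ 0 →
      b (k + 1) (j k) = 0 → b (k + 1) ψ = 0 → (j (k + 1) = χ ∨ j (k + 1) = e') → False :=
    fun hχl hχψ hlψ heχ heψ hrψ hpresχ hminor hbl hbψ hjm =>
      triple_no_drop p hc hw hr0 hfloor hd3 hdp hshade (show k₀ ≤ k + 1 by omega) (hform (k + 1) (by omega))
        (hdir (k + 1) (by omega)) (hform (k + 2) (by omega)) (hlam (k + 1) (by omega)) (hprop (k + 1) (by omega))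
        (hw3 (k + 2) (by omega)) hχl hχψ hlψ heχ he'j heψ hr'j1 hrψ hre' hu' hh'm hlin' hpresχ hU (hlam k hk0)
        hcoefS' (fun i hi => hprop k hk0 i hi) hℓe' hminor hbl hbψ hjm
  rcases hcov (j (k + 1)) with hj' | hj' | hj' | hj'
  · -- chart `j k`: keeps `B`, `C`; the step is not a satellite
    obtain ⟨-, hbB', hbC'⟩ := hkeep (by rw [hj']; exact Ne.symm he'j)
    refine ⟨fun hsat => hsat.1 hj', j k, e', _, S', _, _, κ', hjB, hjC, he'j, he'B, he'C, hu', hh'm, hlin', hpres,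
      hr'B1, hr'C1, hre', hℓ'e', hbB', hbC', ?_, ?_⟩
    · rw [hj']; exact hjB
    · rw [hj']; exact hjC
  · -- chart `B`: illegal
    exfalso
    obtain ⟨hbl, -, hbC'⟩ := hkeep (by rw [hj']; exact Ne.symm he'B)
    exact hnodrop (Ne.symm hjB) hμν hjC he'B he'C hr'C1 hpresB hmB hbl hbC' (Or.inl hj')
  · -- chart `C`: illegal
    exfalso
    obtain ⟨hbl, hbB', -⟩ := hkeep (by rw [hj']; exact Ne.symm he'C)
    exact hnodrop (Ne.symm hjC) hμν.symm hjB he'C he'B hr'B1 hpresC hmC hbl hbB' (Or.inl hj')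
  · -- the free chart `e'`
    by_cases hbB' : b (k + 1) μ = 0
    · by_cases hbC' : b (k + 1) ν = 0
      · -- keeps `B`, `C`; it translates `j k` (else the direction equation fails): not a satellite
        have hbl : b (k + 1) (j k) ≠ 0 := by
          intro h0
          have h1 := hdir (k + 1) (by omega)
          have h2 : dotProduct (ℓ (k + 1)) (b (k + 1)) = 0 := by
            unfold dotProduct
            rw [sum_univ_of_four hjB hjC (Ne.symm he'j) hμν (Ne.symm he'B) (Ne.symm he'C), h0, hbB', hbC',
              show b (k + 1) e' = 0 by rw [← hj']; exact hbj']
            ring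
          rw [h2, add_zero, hj'] at h1
          exact hℓ'e' h1
        refine ⟨fun hsat => hbl hsat.2, j k, e', _, S', _, _, κ', hjB, hjC, he'j, he'B, he'C, hu', hh'm, hlin',
          hpres, hr'B1, hr'C1, hre', hℓ'e', hbB', hbC', ?_, ?_⟩
        · rw [hj']; exact he'B
        · rw [hj']; exact he'C
      · -- translates `C`: illegal
        exfalso
        have hbl : b (k + 1) (j k) = 0 := by
          rcases hfree hj' with h1 | h1 | h1
          · exact h1.1
          · exact h1.1
          · exact absurd h1.2 hbC'
        exact hnodrop (Ne.symm hjC) hμν.symm hjB he'C he'B hr'B1 hpresC hmC hbl hbB' (Or.inr hj')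
    · -- translates `B`: illegal
      exfalso
      have hkl : b (k + 1) (j k) = 0 ∧ b (k + 1) ν = 0 := by
        rcases hfree hj' with h1 | h1 | h1
        · exact absurd h1.2 hbB'
        · exact h1
        · exact absurd h1.1 hbB'
      exact hnodrop (Ne.symm hjB) hμν hjC he'B he'C hr'C1 hpresB hmB hkl.1 hkl.2 (Or.inr hj')

/-- **NO INFINITE LIGHT TRIPLE TAIL** (K25c, the A∞ assembly; statement in the module docstring): once a light
slice-B stretch (`d = 3`) carries a triple-merged ledger on `{N, B, C}` with the fourth letter free and carrying
the vertex form, and the current step keeps `B` and `C`, the chain cannot be isolated for ever — every later step is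
free with respect to the newest letter, against the free-tail theorem. [OURS]
[cite: CossartJannsenSaito2020, Thm. 3.10(4), Thm. 3.14, Thm. 9.3] -/
theorem no_light_triple_tail {c : ℕ → State K} {j : ℕ → Fin 4} {b : ℕ → Fin 4 → K}
    (hc : ∀ k, IsIsolated p (c k).F ∧ Step0 p (c k) (c (k + 1))) (hw : FreeTail.IsWitnessedChain p c j b)
    (hr0 : ∀ e ∈ (c 0).F.support, (c 0).r ≤ e) (hfloor : ∀ k, ordZero (c k).F ≠ p) {k₀ d : ℕ} (hd3 : d = 3)
    (hdp : d < p) (hshade : ∀ k, k₀ ≤ k → (c k).shade = (d : ℕ∞)) {ℓ : ℕ → Fin 4 → K} {a0 lam : ℕ → K}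
    (hform : ∀ k, k₀ ≤ k → resForm (c k) = C (a0 k) * (∑ i, C (ℓ k i) * X i) ^ d)
    (hdir : ∀ k, k₀ ≤ k → ℓ k (j k) + dotProduct (ℓ k) (b k) = 0) (hlam : ∀ k, k₀ ≤ k → lam k ≠ 0)
    (hprop : ∀ k, k₀ ≤ k → ∀ i, i ≠ j k → ℓ (k + 1) i = lam k * ℓ k i)
    {μ ν : Fin 4} (hμν : μ ≠ ν) {k₁ : ℕ} (hk₁ : k₀ ≤ k₁)
    (hw3 : ∀ k, k₁ ≤ k → ∀ i₁ i₂ : Fin 4, i₁ ≠ i₂ → 1 ≤ (c k).r i₁ → 1 ≤ (c k).r i₂ →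
      p ≤ (c k).r i₁ + (c k).r i₂ + 3)
    {N e : Fin 4} {u S T h : MvPolynomial (Fin 4) K} {κ : K}
    (hNB : N ≠ μ) (hNC : N ≠ ν) (heN : e ≠ N) (heB : e ≠ μ) (heC : e ≠ ν)
    (hu : MvPolynomial.eval (0 : Fin 4 → K) u ≠ 0) (hh : h ∈ originIdeal K)
    (hlin : homogeneousComponent 1 h = C κ * (∑ i, C (ℓ k₁ i) * X i))
    (hG : u * ((c k₁).F.divMonomial (c k₁).r) = S * (X N * X μ * X ν) + T * h ^ d)
    (hrB : 1 ≤ (c k₁).r μ) (hrC : 1 ≤ (c k₁).r ν) (hre : (c k₁).r e = 0)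
    (hℓe : ℓ k₁ e ≠ 0) (hbB : b k₁ μ = 0) (hbC : b k₁ ν = 0) (hjB : j k₁ ≠ μ) (hjC : j k₁ ≠ ν) : False := by
  classical
  -- the invariant along the tail
  have key : ∀ k, k₁ ≤ k → ∃ (N' e' : Fin 4) (u' S' T' h' : MvPolynomial (Fin 4) K) (κ' : K),
      N' ≠ μ ∧ N' ≠ ν ∧ e' ≠ N' ∧ e' ≠ μ ∧ e' ≠ ν ∧
      MvPolynomial.eval (0 : Fin 4 → K) u' ≠ 0 ∧ h' ∈ originIdeal K ∧
      homogeneousComponent 1 h' = C κ' * (∑ i, C (ℓ k i) * X i) ∧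
      u' * ((c k).F.divMonomial (c k).r) = S' * (X N' * X μ * X ν) + T' * h' ^ d ∧
      1 ≤ (c k).r μ ∧ 1 ≤ (c k).r ν ∧ (c k).r e' = 0 ∧
      ℓ k e' ≠ 0 ∧ b k μ = 0 ∧ b k ν = 0 ∧ j k ≠ μ ∧ j k ≠ ν := by
    intro k hk
    induction k, hk using Nat.le_induction with
    | base =>
      exact ⟨N, e, u, S, T, h, κ, hNB, hNC, heN, heB, heC, hu, hh, hlin, hG, hrB, hrC, hre, hℓe, hbB, hbC,
        hjB, hjC⟩
    | succ k hk ih =>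
      obtain ⟨N', e', u', S', T', h', κ', hNB', hNC', heN', heB', heC', hu', hh', hlin', hG', hrB', hrC', hre',
        hℓe', hbB', hbC', hjB', hjC'⟩ := ih
      exact (lightTriple_step p hc hw hr0 hfloor hd3 hdp hshade hform hdir hlam hprop hμν hk₁ hw3 hk hNB' hNC' heN'
        heB' heC' hu' hh' hlin' hG' hrB' hrC' hre' hℓe' hbB' hbC' hjB' hjC').2
  -- hence every later step is free, against the free-tail theorem
  have hfreeT : ∀ k, k₁ ≤ k → ¬ FreeTail.IsSatellite j b k := by
    intro k hk
    obtain ⟨N', e', u', S', T', h', κ', hNB', hNC', heN', heB', heC', hu', hh', hlin', hG', hrB', hrC', hre',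
      hℓe', hbB', hbC', hjB', hjC'⟩ := key k hk
    exact (lightTriple_step p hc hw hr0 hfloor hd3 hdp hshade hform hdir hlam hprop hμν hk₁ hw3 hk hNB' hNC' heN'
      heB' heC' hu' hh' hlin' hG' hrB' hrC' hre' hℓe' hbB' hbC' hjB' hjC').1
  obtain ⟨k, hk⟩ := FreeTailProof.noIsolatedFreeTailAt_self p K c j b k₁ hw hfreeT
  exact hk (hc k).1

end Chain

/-- **NO INFINITE LIGHT TRIPLE TAIL at `p = 5`** (K25c): the light bound `5 ≤ r_X + r_Y + 3` is automatic for two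
letters of positive weight, so the A∞ class of K2(5)'s light power-cone regime carries no infinite isolated chain
beyond a triple-merged entry state. [OURS] [cite: CossartJannsenSaito2020, Thm. 3.10(4), Thm. 3.14, Thm. 9.3] -/
theorem no_light_triple_tail_five [CharP K 5] [DecidableEq K] {c : ℕ → State K} {j : ℕ → Fin 4}
    {b : ℕ → Fin 4 → K} (hc : ∀ k, IsIsolated 5 (c k).F ∧ Step0 5 (c k) (c (k + 1)))
    (hw : FreeTail.IsWitnessedChain 5 c j b) (hr0 : ∀ e ∈ (c 0).F.support, (c 0).r ≤ e)
    (hfloor : ∀ k, ordZero (c k).F ≠ (5 : ℕ)) {k₀ d : ℕ} (hd3 : d = 3)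
    (hshade : ∀ k, k₀ ≤ k → (c k).shade = (d : ℕ∞)) {ℓ : ℕ → Fin 4 → K} {a0 lam : ℕ → K}
    (hform : ∀ k, k₀ ≤ k → resForm (c k) = C (a0 k) * (∑ i, C (ℓ k i) * X i) ^ d)
    (hdir : ∀ k, k₀ ≤ k → ℓ k (j k) + dotProduct (ℓ k) (b k) = 0) (hlam : ∀ k, k₀ ≤ k → lam k ≠ 0)
    (hprop : ∀ k, k₀ ≤ k → ∀ i, i ≠ j k → ℓ (k + 1) i = lam k * ℓ k i)
    {μ ν : Fin 4} (hμν : μ ≠ ν) {k₁ : ℕ} (hk₁ : k₀ ≤ k₁)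
    {N e : Fin 4} {u S T h : MvPolynomial (Fin 4) K} {κ : K}
    (hNB : N ≠ μ) (hNC : N ≠ ν) (heN : e ≠ N) (heB : e ≠ μ) (heC : e ≠ ν)
    (hu : MvPolynomial.eval (0 : Fin 4 → K) u ≠ 0) (hh : h ∈ originIdeal K)
    (hlin : homogeneousComponent 1 h = C κ * (∑ i, C (ℓ k₁ i) * X i))
    (hG : u * ((c k₁).F.divMonomial (c k₁).r) = S * (X N * X μ * X ν) + T * h ^ d)
    (hrB : 1 ≤ (c k₁).r μ) (hrC : 1 ≤ (c k₁).r ν) (hre : (c k₁).r e = 0)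
    (hℓe : ℓ k₁ e ≠ 0) (hbB : b k₁ μ = 0) (hbC : b k₁ ν = 0) (hjB : j k₁ ≠ μ) (hjC : j k₁ ≠ ν) : False := by
  haveI : Fact (Nat.Prime 5) := ⟨by norm_num⟩
  exact no_light_triple_tail 5 hc hw hr0 hfloor hd3 (by omega) hshade hform hdir hlam hprop hμν hk₁
    (fun k _ i₁ i₂ _ h1 h2 => by omega) hNB hNC heN heB heC hu hh hlin hG hrB hrC hre hℓe hbB hbC hjB hjC

end ResCone

end Summit.ResolutionOfSingularities.ResolutionOfSingularities.Theorems.PIDim4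

end
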